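import Mathlib
import Summits.ValiantsHypothesis.ValiantsHypothesis.Theorems.NewtonUnitEquationsDissociatedUniformTotalsLawChartTops
import Literature.Computability.AlgebraicComplexity.NewtonPolygonTauProductBounds
import HarnessLib

/-!
# Crux `NewtonUnitEquations.DissociatedUniform` (stmt-ValiantsHypothesis-5905): totals law — LEVELS along a chart (low tie events, top ties, top-`k` sets)

Tool file for the middle regime of the `n = 3` totals law / the union-of-fibres law (memo
`Cruxes/DissociatedUniform/NOTES-t1g4.md` §4, bricks (R2)–(R3)).  Along the affine chart of weights `t ↦ (σ, t)` every point `p` of a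
finite planar set `F` is the LINE `t ↦ ⟨(σ,t), p⟩ = σ p₀ + t p₁`; the depth bookkeeping of the memo needs the classical fact that
the top-`k` set of `F` changes only `O(|F|·k)` times along the chart (the `(≤ k)`-level bound for lines).  This file sets up the
objects and proves the first structural lemma; the counting (Clarkson–Shor double count) is the companion `…TotalsLawChartLevelsCount`.

* `above σ F t v`, `tied σ F t v`: the points of `F` strictly above / exactly at the value `v` at time `t`;
  `IsLowEvent σ F k (τ, v)`: at least two points tie at `(τ, v)` with fewer than `k` points strictly above ("a vertex of the
  arrangement at level `< k`", robust under concurrency: one event per (time, value), not per pair); `lowEvents σ F k` its finite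
  set (`mem_lowEvents`).
* `IsTopTie σ R τ` / `topTies σ R`: times at which the maximum of `R` is attained by two distinct points (breakpoints of the upper
  envelope of the lines of `R`); **`card_topTies_le`**: `#topTies ≤ |R|` (the point of largest slope among the tied maximisers is a
  different point at every top tie: it is beaten at all earlier times by a tied point of smaller slope).
* (companion `…TotalsLawChartLevelsTopSets`) `rank`, `topSet`, and `exists_lowEvent_of_topSet_ne`: the top-`k` set changes only at
  low events of order `< k`.
Honest label: tool lemmas only; nothing here bears on VP ≠ VNP.
[folklore: levels in arrangements of lines; an upper envelope of `m` lines has at most `m - 1` breakpoints]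
-/

set_option linter.dupNamespace false -- `ValiantsHypothesis.ValiantsHypothesis` (summit = problem) in every name

open scoped BigOperators

namespace Summit.ValiantsHypothesis.ValiantsHypothesis.Theorems.NewtonUnitEquationsDissociatedUniform

namespace TotalsLaw

open Literature.Computability.AlgebraicComplexity.KPTT.PlanarMinkowski

/-! ### Crossing times of two chart lines -/

/-- The time at which the chart lines of `p` and `q` cross (meaningful when `p 1 ≠ q 1`). -/
noncomputable def crossT (σ : ℝ) (p q : Fin 2 → ℝ) : ℝ := -(σ * (p 0 - q 0)) / (p 1 - q 1)

/-- At the crossing time the two scores agree. [folklore] -/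
theorem chart_eq_at_crossT (σ : ℝ) {p q : Fin 2 → ℝ} (h : p 1 ≠ q 1) :
    ![σ, crossT σ p q] ⬝ᵥ p = ![σ, crossT σ p q] ⬝ᵥ q := by
  have h' : p 1 - q 1 ≠ 0 := sub_ne_zero.2 h
  rw [chart_dotProduct, chart_dotProduct, crossT]
  field_simp
  ring

/-- Two lines of different slopes agree only at their crossing time. [folklore] -/
theorem eq_crossT_of_chart_eq (σ : ℝ) {p q : Fin 2 → ℝ} (h : p 1 ≠ q 1) {t : ℝ} (ht : ![σ, t] ⬝ᵥ p = ![σ, t] ⬝ᵥ q) :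
    t = crossT σ p q := by
  have h' : p 1 - q 1 ≠ 0 := sub_ne_zero.2 h
  rw [chart_dotProduct, chart_dotProduct] at ht
  rw [crossT, eq_div_iff h']
  linarith

/-- Distinct points with equal scores at some time have different slopes (`σ ≠ 0`). [folklore] -/
theorem slope_ne_of_chart_eq {σ : ℝ} (hσ : σ ≠ 0) {p q : Fin 2 → ℝ} (hpq : p ≠ q) {t : ℝ}
    (ht : ![σ, t] ⬝ᵥ p = ![σ, t] ⬝ᵥ q) : p 1 ≠ q 1 := by
  intro h1
  apply hpq
  rw [chart_dotProduct, chart_dotProduct, h1] at ht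
  have h0 : p 0 = q 0 := by
    have : σ * (p 0 - q 0) = 0 := by linarith
    rcases mul_eq_zero.1 this with h | h
    · exact absurd h hσ
    · linarith
  ext i
  fin_cases i
  · exact h0
  · exact h1

/-! ### Low tie events -/

section Events

variable (σ : ℝ) (F : Finset (Fin 2 → ℝ))

/-- The points of `F` strictly above the value `v` at time `t`. -/
noncomputable def above (t v : ℝ) : Finset (Fin 2 → ℝ) := F.filter fun p => v < ![σ, t] ⬝ᵥ p

/-- The points of `F` exactly at the value `v` at time `t`. -/
noncomputable def tied (t v : ℝ) : Finset (Fin 2 → ℝ) := F.filter fun p => ![σ, t] ⬝ᵥ p = v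

/-- A LOW TIE EVENT of order `< k`: at (time, value) `e` at least two points of `F` tie and fewer than `k` points of `F` are
strictly above. -/
def IsLowEvent (k : ℕ) (e : ℝ × ℝ) : Prop := 2 ≤ (tied σ F e.1 e.2).card ∧ (above σ F e.1 e.2).card < k

/-- Candidate events: the crossing (time, value) of every pair of points of `F` with different slopes. -/
noncomputable def candEvents : Finset (ℝ × ℝ) :=
  ((F ×ˢ F).filter fun pq => pq.1 1 ≠ pq.2 1).image fun pq => (crossT σ pq.1 pq.2, ![σ, crossT σ pq.1 pq.2] ⬝ᵥ pq.1)

open Classical in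
/-- The finite set of low tie events of order `< k`. -/
noncomputable def lowEvents (k : ℕ) : Finset (ℝ × ℝ) := (candEvents σ F).filter fun e => IsLowEvent σ F k e

variable {σ F}

/-- Two distinct tied points. [folklore] -/
theorem exists_pair_of_two_le_card_tied {t v : ℝ} (h : 2 ≤ (tied σ F t v).card) :
    ∃ p ∈ F, ∃ q ∈ F, p ≠ q ∧ ![σ, t] ⬝ᵥ p = v ∧ ![σ, t] ⬝ᵥ q = v := by
  obtain ⟨p, hp, q, hq, hpq⟩ := Finset.one_lt_card.1 (by omega : 1 < (tied σ F t v).card)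
  rw [tied, Finset.mem_filter] at hp hq
  exact ⟨p, hp.1, q, hq.1, hpq, hp.2, hq.2⟩

/-- **Membership in `lowEvents`** is exactly `IsLowEvent` (`σ ≠ 0`). [folklore] -/
theorem mem_lowEvents (hσ : σ ≠ 0) {k : ℕ} {e : ℝ × ℝ} : e ∈ lowEvents σ F k ↔ IsLowEvent σ F k e := by
  classical
  unfold lowEvents
  rw [Finset.mem_filter]
  constructor
  · exact fun h => h.2
  · intro h
    refine ⟨?_, h⟩
    obtain ⟨p, hp, q, hq, hpq, hpv, hqv⟩ := exists_pair_of_two_le_card_tied h.1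
    have hs : p 1 ≠ q 1 := slope_ne_of_chart_eq hσ hpq (hpv.trans hqv.symm)
    have ht : e.1 = crossT σ p q := eq_crossT_of_chart_eq σ hs (hpv.trans hqv.symm)
    unfold candEvents
    rw [Finset.mem_image]
    refine ⟨(p, q), Finset.mem_filter.2 ⟨Finset.mem_product.2 ⟨hp, hq⟩, hs⟩, ?_⟩
    rw [← ht, hpv]

end Events

/-! ### Top ties of a point set (breakpoints of its upper envelope) -/

section TopTies

variable (σ : ℝ) (R : Finset (Fin 2 → ℝ))

/-- `τ` is a TOP TIE of `R`: two distinct points of `R` attain the maximum score at time `τ`. -/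
def IsTopTie (τ : ℝ) : Prop :=
  ∃ p ∈ R, ∃ q ∈ R, p ≠ q ∧ ![σ, τ] ⬝ᵥ p = ![σ, τ] ⬝ᵥ q ∧ ∀ y ∈ R, ![σ, τ] ⬝ᵥ y ≤ ![σ, τ] ⬝ᵥ p

open Classical in
/-- The finite set of top ties. -/
noncomputable def topTies : Finset ℝ :=
  (((R ×ˢ R).filter fun pq => pq.1 1 ≠ pq.2 1).image fun pq => crossT σ pq.1 pq.2).filter fun τ => IsTopTie σ R τ

variable {σ R}

/-- **Membership in `topTies`** is exactly `IsTopTie` (`σ ≠ 0`). [folklore] -/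
theorem mem_topTies (hσ : σ ≠ 0) {τ : ℝ} : τ ∈ topTies σ R ↔ IsTopTie σ R τ := by
  classical
  unfold topTies
  rw [Finset.mem_filter]
  constructor
  · exact fun h => h.2
  · intro h
    refine ⟨?_, h⟩
    obtain ⟨p, hp, q, hq, hpq, heq, -⟩ := h
    have hs : p 1 ≠ q 1 := slope_ne_of_chart_eq hσ hpq heq
    rw [Finset.mem_image]
    exact ⟨(p, q), Finset.mem_filter.2 ⟨Finset.mem_product.2 ⟨hp, hq⟩, hs⟩, (eq_crossT_of_chart_eq σ hs heq).symm⟩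

/-- At a top tie, among the points attaining the maximum there is one of LARGEST slope, and some other maximiser has strictly
smaller slope. [folklore] -/
theorem exists_steepest_of_isTopTie (hσ : σ ≠ 0) {τ : ℝ} (h : IsTopTie σ R τ) :
    ∃ p ∈ R, (∀ y ∈ R, ![σ, τ] ⬝ᵥ y ≤ ![σ, τ] ⬝ᵥ p) ∧
      (∀ y ∈ R, ![σ, τ] ⬝ᵥ y = ![σ, τ] ⬝ᵥ p → y 1 ≤ p 1) ∧
      ∃ q ∈ R, ![σ, τ] ⬝ᵥ q = ![σ, τ] ⬝ᵥ p ∧ q 1 < p 1 := by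
  classical
  obtain ⟨p₀, hp₀, q₀, hq₀, hne, heq, hmax⟩ := h
  set M := R.filter fun y => ![σ, τ] ⬝ᵥ y = ![σ, τ] ⬝ᵥ p₀ with hM
  have hMne : M.Nonempty := ⟨p₀, Finset.mem_filter.2 ⟨hp₀, rfl⟩⟩
  obtain ⟨p, hpM, hpmax⟩ := M.exists_max_image (fun y => y 1) hMne
  have hp : p ∈ R := (Finset.mem_filter.1 hpM).1
  have hpv : ![σ, τ] ⬝ᵥ p = ![σ, τ] ⬝ᵥ p₀ := (Finset.mem_filter.1 hpM).2
  refine ⟨p, hp, fun y hy => by rw [hpv]; exact hmax y hy, fun y hy hyp => hpmax y (Finset.mem_filter.2 ⟨hy, hyp.trans hpv⟩), ?_⟩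
  -- another maximiser with smaller slope: `p₀` or `q₀`, whichever differs from `p`
  by_cases hpp : p = p₀
  · refine ⟨q₀, hq₀, by rw [hpv, heq], lt_of_le_of_ne (hpmax q₀ (Finset.mem_filter.2 ⟨hq₀, heq.symm⟩)) ?_⟩
    rw [hpp]
    exact (slope_ne_of_chart_eq hσ hne heq).symm
  · refine ⟨p₀, hp₀, hpv.symm, lt_of_le_of_ne (hpmax p₀ (Finset.mem_filter.2 ⟨hp₀, rfl⟩)) ?_⟩
    exact (slope_ne_of_chart_eq hσ hpp hpv).symm

/-- **An upper envelope of `|R|` lines has at most `|R|` breakpoints**: `#topTies σ R ≤ |R|`.  The steepest tied maximiser is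
injective in the top tie: at an earlier time it is beaten by its tied partner of smaller slope, so it cannot be a maximiser there.
[folklore: an upper envelope of `m` lines has at most `m - 1` breakpoints] -/
theorem card_topTies_le (hσ : σ ≠ 0) : (topTies σ R).card ≤ R.card := by
  classical
  -- the steepest maximiser at each top tie
  have hst : ∀ τ ∈ topTies σ R, ∃ p ∈ R, (∀ y ∈ R, ![σ, τ] ⬝ᵥ y ≤ ![σ, τ] ⬝ᵥ p) ∧
      (∀ y ∈ R, ![σ, τ] ⬝ᵥ y = ![σ, τ] ⬝ᵥ p → y 1 ≤ p 1) ∧ ∃ q ∈ R, ![σ, τ] ⬝ᵥ q = ![σ, τ] ⬝ᵥ p ∧ q 1 < p 1 :=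
    fun τ hτ => exists_steepest_of_isTopTie hσ ((mem_topTies hσ).1 hτ)
  choose! f hfR hfmax hfslope hfpartner using hst
  refine Finset.card_le_card_of_injOn f (fun τ hτ => hfR τ hτ) ?_
  -- injectivity
  have key : ∀ τ₁ ∈ topTies σ R, ∀ τ₂ ∈ topTies σ R, τ₁ < τ₂ → f τ₁ ≠ f τ₂ := by
    intro τ₁ h₁ τ₂ h₂ hlt heq
    obtain ⟨q, hq, hqv, hqs⟩ := hfpartner τ₂ h₂
    -- at the earlier time `τ₁`, `q` beats `f τ₂ = f τ₁`
    have ha := chart_dotProduct_sub_affine σ τ₁ τ₂ q (f τ₂)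
    have hpos : (τ₁ - τ₂) * (q 1 - f τ₂ 1) > 0 := mul_pos_of_neg_of_neg (by linarith) (by linarith)
    have h1 : ![σ, τ₁] ⬝ᵥ q > ![σ, τ₁] ⬝ᵥ f τ₂ := by linarith
    have h2 := hfmax τ₁ h₁ q hq
    rw [heq] at h2
    linarith
  intro τ₁ h₁ τ₂ h₂ heq
  by_contra hne
  rcases lt_or_gt_of_ne hne with hlt | hlt
  · exact key τ₁ h₁ τ₂ h₂ hlt heq
  · exact key τ₂ h₂ τ₁ h₁ hlt heq.symm

end TopTies

end TotalsLaw

end Summit.ValiantsHypothesis.ValiantsHypothesis.Theorems.NewtonUnitEquationsDissociatedUniform
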